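import Mathlib
import Literature.LinearAlgebra.QuadraticForm.SelfAdjointSymmetrization
import HarnessLib

/-!
# Symmetric spectral representations over `ℝ[x]` from self-dual positive lattices (Bender–Hanselka)

Topic `Literature/AlgebraicGeometry/DeterminantalHypersurfaces`. The assembly step of the proof of
C. Hanselka, *Characteristic polynomials of symmetric matrices over the univariate polynomial
ring*, J. Algebra 487 (2017) 340–356 (arXiv:1610.06634), **§5** (after E. A. Bender, *Classes
of matrices over an integral domain*, Illinois J. Math. 11 (1967)): given the `K = ℝ(x)`-algebra
`L = K[t]/(f)` of a monic `f ∈ ℝ[x][t]`, an `ℝ[x]`-lattice `I ⊂ L` stable under multiplication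
by `t̄`, with an `ℝ[x]`-basis `b`, and a scaling factor `c ∈ L` such that the scaled trace form
`β(u,v) = Tr_{L|K}(c·u·v)` takes values in `ℝ[x]` on `I`, "Denote `μ` multiplication by `t̄` …
Its characteristic polynomial is `f`. Since any `A`-basis of `I` is also a `K`-basis of `L`, the
restriction of `μ` to `I` has characteristic polynomial `f` as well. Since `μ` is obviously
self-adjoint with respect to `β`, its representing matrix `M` with respect to the orthonormal
basis `ℬ` of `I` is symmetric, hence `M` is a symmetric spectral representation of `f`."

In matrix terms the data are the matrix `N ∈ Mₙ(ℝ[x])` of `μ` in the basis `b`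
(`t̄·bⱼ = Σᵢ Nᵢⱼ bᵢ`) and the Gram matrix `G ∈ Mₙ(ℝ[x])` of `β` (`Gᵢⱼ = Tr(c bᵢ bⱼ)`):

* `transpose_mul_eq_mul_of_trace_form` — `μ` is self-adjoint for `β`: `NᵀG = GN` [folklore /
  Hanselka §5];
* `charpoly_eq_of_powerBasis` — the matrix of multiplication by the generator of a power basis
  with minimal polynomial `f`, taken in ANY `K`-basis and having entries in `ℝ[x]`, has
  characteristic polynomial `f` [folklore / Hanselka §5];
* `exists_isSymm_charpoly_eq_of_lattice_data` — **the assembly** [cite: Hanselka2017, §5]: if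
  moreover `det G` is a unit (β unimodular on `I`, ibid. Lemma 2.1) and `G(a)` is positive
  semidefinite for every real `a` (ibid., from `c` a sum of squares), then `f` has a symmetric
  spectral representation over `ℝ[x]` — via `exists_isSymm_charpoly_eq_of_selfAdjoint`
  (orthonormal basis from the Harder–Djoković theorem, `SelfAdjointSymmetrization.lean`).

The first two statements are proved for any commutative ring `R` in place of `ℝ[x]`, any
commutative `R`-algebra `K` with injective structure map, and any commutative `K`-algebra `L`.
What is NOT here is the construction of the data `(I, c)` with `cI² = Δ(B|A)` and `c` a sum of
squares (ibid. Lemma 2.1, Cor. 3.5, Thm. 4.1/Cor. 4.2) — the remaining content of Hanselka's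
Theorem 1, hypothesis `H` of `laxConjecture_of_symmSpectralRepresentation`.

## References

* [Hanselka2017] C. Hanselka, J. Algebra 487 (2017) 340–356: §5 (proof of Thm. 1), Lemma 2.1.
* E. A. Bender, Classes of matrices over an integral domain, Illinois J. Math. 11 (1967) 697–702.
-/

noncomputable section

open Polynomial Matrix

namespace Literature.AlgebraicGeometry.DeterminantalHypersurfaces

section General

variable {R K L ι : Type*} [CommRing R] [CommRing K] [CommRing L] [Algebra R K] [Algebra K L]
  [Fintype ι] [DecidableEq ι]

omit [DecidableEq ι] in
/-- **Multiplication operators are self-adjoint for scaled trace forms.** If `N` is the matrix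
of multiplication by `θ` in a `K`-basis `b` of `L` (`θ bⱼ = Σᵢ Nᵢⱼ bᵢ`, entries in `R ⊆ K`) and
`G` is the Gram matrix of `(u,v) ↦ Tr_{L|K}(c u v)` in that basis (entries in `R`), then
`NᵀG = GN`. [folklore] -/
theorem transpose_mul_eq_mul_of_trace_form (b : Module.Basis ι K L) (θ c : L) (N G : Matrix ι ι R)
    (hN : ∀ j, θ * b j = ∑ i, algebraMap R K (N i j) • b i)
    (hG : ∀ i j, algebraMap R K (G i j) = Algebra.trace K L (c * (b i * b j)))
    (hinj : Function.Injective (algebraMap R K)) : Nᵀ * G = G * N := by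
  apply Matrix.map_injective hinj
  refine Matrix.ext fun i j => ?_
  simp only [Matrix.map_apply, Matrix.mul_apply, Matrix.transpose_apply, map_sum, map_mul, hG]
  have key1 : ∑ k, algebraMap R K (N k i) * Algebra.trace K L (c * (b k * b j)) =
      Algebra.trace K L (c * ((θ * b i) * b j)) := by
    rw [hN i, Finset.sum_mul, Finset.mul_sum, map_sum]
    refine Finset.sum_congr rfl fun k _ => ?_
    rw [smul_mul_assoc, mul_smul_comm, map_smul, smul_eq_mul]
  have key2 : ∑ k, Algebra.trace K L (c * (b i * b k)) * algebraMap R K (N k j) =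
      Algebra.trace K L (c * (b i * (θ * b j))) := by
    rw [hN j, Finset.mul_sum, Finset.mul_sum, map_sum]
    refine Finset.sum_congr rfl fun k _ => ?_
    rw [mul_smul_comm, mul_smul_comm, map_smul, smul_eq_mul, mul_comm]
  rw [key1, key2]
  congr 2
  ring

/-- **Characteristic polynomial of multiplication by a power-basis generator, in any basis.**
If `pb` is a power basis of `L` over `K` whose generator has minimal polynomial `f ∈ R[t]`
(mapped to `K`), and `N ∈ Mₙ(R)` is the matrix of multiplication by `pb.gen` in some `K`-basis
`b` of `L`, then `charpoly N = f`. [folklore] -/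
theorem charpoly_eq_of_powerBasis (pb : PowerBasis K L) (b : Module.Basis ι K L) (N : Matrix ι ι R)
    (hN : ∀ j, pb.gen * b j = ∑ i, algebraMap R K (N i j) • b i)
    (hinj : Function.Injective (algebraMap R K)) {f : R[X]}
    (hf : minpoly K pb.gen = f.map (algebraMap R K)) : N.charpoly = f := by
  classical
  haveI := Module.Free.of_basis pb.basis
  haveI := Module.Finite.of_basis pb.basis
  have hNb : N.map (algebraMap R K) = LinearMap.toMatrix b b (Algebra.lmul K L pb.gen) := by
    refine Matrix.ext fun i j => ?_
    rw [Matrix.map_apply, LinearMap.toMatrix_apply, Algebra.coe_lmul_eq_mul, LinearMap.mul_apply',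
      hN j, b.repr_sum_self]
  apply Polynomial.map_injective (algebraMap R K) hinj
  rw [← hf, ← Matrix.charpoly_map, hNb, LinearMap.charpoly_toMatrix,
    ← LinearMap.charpoly_toMatrix _ pb.basis, ← Algebra.leftMulMatrix_apply,
    charpoly_leftMulMatrix]

end General

/-- **Bender–Hanselka assembly** ([Hanselka2017, §5, proof of Thm. 1]): let `f ∈ ℝ[x][t]` be
monic, `K` a field of fractions of `ℝ[x]`, `L` a commutative `K`-algebra with a power basis `pb`
whose generator has minimal polynomial `f` (e.g. `L = K[t]/(f)`, `pb.gen = t̄`), `b` a `K`-basis of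
`L` spanning a lattice stable under `pb.gen` with matrix `N ∈ Mₙ(ℝ[x])`, and `c ∈ L` such that the
Gram matrix `G ∈ Mₙ(ℝ[x])` of `Tr_{L|K}(c·uv)` in the basis `b` is unimodular and positive
semidefinite at every real point. Then `f` is the characteristic polynomial of a SYMMETRIC matrix
over `ℝ[x]`. [cite: Hanselka2017, §5 (proof of Theorem 1: "its representing matrix … with
respect to the orthonormal basis … is symmetric")] -/
theorem exists_isSymm_charpoly_eq_of_lattice_data {K L ι : Type*} [Field K] [CommRing L]
    [Algebra ℝ[X] K] [IsFractionRing ℝ[X] K] [Algebra K L] [Fintype ι] [DecidableEq ι]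
    {f : ℝ[X][X]} (pb : PowerBasis K L) (hf : minpoly K pb.gen = f.map (algebraMap ℝ[X] K))
    (b : Module.Basis ι K L) (c : L) (N G : Matrix ι ι ℝ[X])
    (hN : ∀ j, pb.gen * b j = ∑ i, algebraMap ℝ[X] K (N i j) • b i)
    (hG : ∀ i j, algebraMap ℝ[X] K (G i j) = Algebra.trace K L (c * (b i * b j)))
    (hdet : IsUnit G.det) (hpsd : ∀ a : ℝ, (G.map (Polynomial.eval a)).PosSemidef) :
    ∃ M : Matrix ι ι ℝ[X], M.IsSymm ∧ M.charpoly = f := by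
  have hinj : Function.Injective (algebraMap ℝ[X] K) := IsFractionRing.injective ℝ[X] K
  have hNG := transpose_mul_eq_mul_of_trace_form b pb.gen c N G hN hG hinj
  have hchar := charpoly_eq_of_powerBasis pb b N hN hinj hf
  obtain ⟨M, hM, hMN⟩ :=
    Literature.LinearAlgebra.QuadraticForm.exists_isSymm_charpoly_eq_of_selfAdjoint N G hNG hpsd hdet
  exact ⟨M, hM, hMN.trans hchar⟩

end Literature.AlgebraicGeometry.DeterminantalHypersurfaces
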